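import Mathlib.CategoryTheory.Comma.Arrow
import Literature.AlgebraicGeometry.Frobenioids.Dissection
import Literature.AlgebraicGeometry.Frobenioids.EquivalenceTransport
import HarnessLib

/-!
# Frobenioids II, §0 (p. 5): the dissection vocabulary is invariant under equivalences of categories

Mochizuki, *The geometry of Frobenioids II: poly-Frobenioids*, Kyushu J. Math. **62** (2008)
401–460, §0 "Notations and Conventions", paragraph **Categories**, kurims text p. 5
[cite: MochizukiFrdII2008, §0 p.5]: strongly / weakly dissecting families `{φᵢ : Aᵢ → A}` of arrows
with "nonempty [i.e., non-initial]" domains, strongly / weakly (in)dissectible objects, the four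
"types" of categories, and the three kinds of functors (arrow-wise essentially surjective, relatively
initial, totally non-initial) — typed in `Dissection.lean` (abc-iut-L1-t4).

All of these are phrased purely in the language of the category, so the paper transports them along
equivalences of categories without comment — e.g. in the proof of Thm. 5.5 (p. 60: "the horizontal
arrows are equivalences of categories … the necessary 'dissection' of `C_i^pf` follows immediately from
the dissection already discussed of `C_i`") and whenever a "category-theoretic" reconstruction is read
off an equivalent category.  This file is the [FrdII] §0 p. 5 companion of `EquivalenceTransport.lean`
(which does the same for the [FrdI] §0 classes of arrows) and PROVES, for an equivalence `e : C ≌ D`: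

* `IsNonemptyObj.map_equivalence` / `isNonemptyObj_map_equivalence_iff`: `A` is non-initial iff
  `e(A)` is (a fully faithful functor reflects initial objects);
* `stronglyDissects_map_equivalence_iff`, `weaklyDissects_map_equivalence_iff`: a family
  `{φᵢ}` strongly / weakly dissects `A` iff `{e(φᵢ)}` strongly / weakly dissects `e(A)`;
* `StronglyDissects.comp`, `WeaklyDissects.comp_mono`, `….of_iso`: post-composition with an
  isomorphism (any arrow, resp. any monomorphism) preserves dissecting families, so (in)dissectibility
  of an object is isomorphism-invariant;
* `is{Strongly,Weakly}{Dissectible,Indissectible}_map_equivalence_iff`: the four object predicates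
  are invariant; `isOf{…}Type_iff_of_equivalence`: the four TYPES of categories are invariant;
* `isTotallyNonInitial_comp_equivalence_iff`, `isRelativelyInitial_comp_equivalence_iff`,
  `isArrowwiseEssSurj_comp_equivalence_iff` (and the `equivalence_comp` versions): the three functor
  notions are unchanged by composing with an equivalence on either side.

PROOF-ONLY (no definitions, no instances); elementary category theory over Mathlib's `Equivalence`,
`Functor.objPreimage`, `Functor.mapArrow`.  Nothing here bears on the disputed [IUTchIII] Cor. 3.12 or
takes a side; no FACT-LIST row is asserted (abc-iut cell, seat abc-iut-f-031, by-product of tranche 31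
`IsOfWeaklyDissectibleType` F-2328 — the instance forms the tree consumes become transportable).
-/

namespace Literature.AlgebraicGeometry.Frobenioids

open CategoryTheory CategoryTheory.Limits

universe w v₁ v₂ v₃ u₁ u₂ u₃

variable {C : Type u₁} [Category.{v₁} C] {D : Type u₂} [Category.{v₂} D] (e : C ≌ D)

/-! ### Non-initial ("nonempty") objects -/

/-- An equivalence carries non-initial objects to non-initial objects: a fully faithful functor
reflects initial objects ([FrdI] §0 p. 15 "nonempty [i.e., non-initial]", as used on [FrdII] §0 p. 5).
[cite: MochizukiFrdII2008, §0 p.5] -/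
theorem IsNonemptyObj.map_equivalence {A : C} (h : IsNonemptyObj A) :
    IsNonemptyObj (e.functor.obj A) :=
  ⟨fun hI => h.false
    (IsInitial.ofUniqueHom (fun Y => e.functor.preimage (hI.to (e.functor.obj Y)))
      fun Y m => e.functor.map_injective (by
        rw [Functor.map_preimage]
        exact hI.hom_ext _ _))⟩

/-- Conversely, if `e(A)` is non-initial then so is `A` (apply the previous statement to `e⁻¹` and
transport along the unit `A ≅ e⁻¹ e A`). [cite: MochizukiFrdII2008, §0 p.5] -/
theorem IsNonemptyObj.of_map_equivalence {A : C} (h : IsNonemptyObj (e.functor.obj A)) :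
    IsNonemptyObj A :=
  ⟨fun hA => (h.map_equivalence e.symm).false (hA.ofIso (e.unitIso.app A))⟩

/-- `e(A)` is non-initial iff `A` is. [cite: MochizukiFrdII2008, §0 p.5] -/
theorem isNonemptyObj_map_equivalence_iff (A : C) :
    IsNonemptyObj (e.functor.obj A) ↔ IsNonemptyObj A :=
  ⟨fun h => h.of_map_equivalence e, fun h => h.map_equivalence e⟩

/-- An object `X'` of `D` is non-initial iff the chosen preimage `e⁻¹ X'` (with `e(e⁻¹ X') ≅ X'`) is.
[cite: MochizukiFrdII2008, §0 p.5] -/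
theorem isNonemptyObj_objPreimage_iff (X' : D) :
    IsNonemptyObj (e.functor.objPreimage X') ↔ IsNonemptyObj X' := by
  rw [← isNonemptyObj_map_equivalence_iff e]
  exact ⟨fun h => ⟨fun hX => h.false (hX.ofIso (e.functor.objObjPreimageIso X').symm)⟩,
    fun h => ⟨fun hX => h.false (hX.ofIso (e.functor.objObjPreimageIso X'))⟩⟩

/-! ### Dissecting families -/

/-- An equivalence carries a strongly dissecting family `{φᵢ : Aᵢ → A}` to a strongly dissecting
family `{e(φᵢ) : e(Aᵢ) → e(A)}`: a pair of arrows `B' → e(Aᵢ)`, `B' → e(Aⱼ)` from a non-initial `B'`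
pulls back to a pair `e⁻¹B' → Aᵢ`, `e⁻¹B' → Aⱼ`. [cite: MochizukiFrdII2008, §0 p.5] -/
theorem StronglyDissects.map_equivalence {ι : Type w} {A : C} {X : ι → C} {φ : ∀ i, X i ⟶ A}
    (h : StronglyDissects φ) :
    StronglyDissects (X := fun i => e.functor.obj (X i)) fun i => e.functor.map (φ i) := by
  refine ⟨fun i => (h.1 i).map_equivalence e, ?_⟩
  rintro i j hij B' hB' ⟨⟨ψi'⟩, ⟨ψj'⟩⟩
  obtain ⟨ψi, -⟩ := exists_preimage_to e ψi'
  obtain ⟨ψj, -⟩ := exists_preimage_to e ψj'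
  exact h.2 hij ((isNonemptyObj_objPreimage_iff e B').mpr hB') ⟨⟨ψi⟩, ⟨ψj⟩⟩

/-- Conversely, if `{e(φᵢ)}` strongly dissects `e(A)` then `{φᵢ}` strongly dissects `A`.
[cite: MochizukiFrdII2008, §0 p.5] -/
theorem StronglyDissects.of_map_equivalence {ι : Type w} {A : C} {X : ι → C} {φ : ∀ i, X i ⟶ A}
    (h : StronglyDissects (X := fun i => e.functor.obj (X i)) fun i => e.functor.map (φ i)) :
    StronglyDissects φ := by
  refine ⟨fun i => (h.1 i).of_map_equivalence e, ?_⟩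
  rintro i j hij B hB ⟨⟨ψi⟩, ⟨ψj⟩⟩
  exact h.2 hij (hB.map_equivalence e) ⟨⟨e.functor.map ψi⟩, ⟨e.functor.map ψj⟩⟩

/-- `{e(φᵢ)}` strongly dissects `e(A)` iff `{φᵢ}` strongly dissects `A`.
[cite: MochizukiFrdII2008, §0 p.5] -/
theorem stronglyDissects_map_equivalence_iff {ι : Type w} {A : C} {X : ι → C}
    (φ : ∀ i, X i ⟶ A) :
    StronglyDissects (X := fun i => e.functor.obj (X i)) (fun i => e.functor.map (φ i)) ↔
      StronglyDissects φ :=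
  ⟨fun h => h.of_map_equivalence e, fun h => h.map_equivalence e⟩

/-- An equivalence carries a weakly dissecting family to a weakly dissecting family: an equation
`ψᵢ' ≫ e(φᵢ) = ψⱼ' ≫ e(φⱼ)` out of a non-initial `B'` pulls back, by faithfulness, to an equation
`ψᵢ ≫ φᵢ = ψⱼ ≫ φⱼ` out of the non-initial `e⁻¹B'`. [cite: MochizukiFrdII2008, §0 p.5] -/
theorem WeaklyDissects.map_equivalence {ι : Type w} {A : C} {X : ι → C} {φ : ∀ i, X i ⟶ A}
    (h : WeaklyDissects φ) :
    WeaklyDissects (X := fun i => e.functor.obj (X i)) fun i => e.functor.map (φ i) := by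
  refine ⟨fun i => (h.1 i).map_equivalence e, ?_⟩
  intro i j hij B' hB' ψi' ψj' heq
  have heq' : ψi' ≫ e.functor.map (φ i) = ψj' ≫ e.functor.map (φ j) := heq
  obtain ⟨ψi, hψi⟩ := exists_preimage_to e ψi'
  obtain ⟨ψj, hψj⟩ := exists_preimage_to e ψj'
  refine h.2 hij ((isNonemptyObj_objPreimage_iff e B').mpr hB') ψi ψj
    (e.functor.map_injective ?_)
  simp only [Functor.map_comp, hψi, hψj, Category.assoc, heq']

/-- Conversely, if `{e(φᵢ)}` weakly dissects `e(A)` then `{φᵢ}` weakly dissects `A`.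
[cite: MochizukiFrdII2008, §0 p.5] -/
theorem WeaklyDissects.of_map_equivalence {ι : Type w} {A : C} {X : ι → C} {φ : ∀ i, X i ⟶ A}
    (h : WeaklyDissects (X := fun i => e.functor.obj (X i)) fun i => e.functor.map (φ i)) :
    WeaklyDissects φ := by
  refine ⟨fun i => (h.1 i).of_map_equivalence e, ?_⟩
  intro i j hij B hB ψi ψj heq
  exact h.2 hij (hB.map_equivalence e) (e.functor.map ψi) (e.functor.map ψj)
    (by simp only [← Functor.map_comp, heq])

/-- `{e(φᵢ)}` weakly dissects `e(A)` iff `{φᵢ}` weakly dissects `A`.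
[cite: MochizukiFrdII2008, §0 p.5] -/
theorem weaklyDissects_map_equivalence_iff {ι : Type w} {A : C} {X : ι → C}
    (φ : ∀ i, X i ⟶ A) :
    WeaklyDissects (X := fun i => e.functor.obj (X i)) (fun i => e.functor.map (φ i)) ↔
      WeaklyDissects φ :=
  ⟨fun h => h.of_map_equivalence e, fun h => h.map_equivalence e⟩

/-! ### Post-composition; isomorphism invariance of (in)dissectibility -/

/-- Strong dissection is a condition on the domains `Aᵢ` alone, so it is unchanged by post-composing
the family with any arrow `g : A → A'`. [cite: MochizukiFrdII2008, §0 p.5] -/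
theorem StronglyDissects.comp {ι : Type w} {A A' : C} {X : ι → C} {φ : ∀ i, X i ⟶ A}
    (h : StronglyDissects φ) (g : A ⟶ A') : StronglyDissects fun i => φ i ≫ g :=
  h

/-- Conversely (same remark). [cite: MochizukiFrdII2008, §0 p.5] -/
theorem StronglyDissects.of_comp {ι : Type w} {A A' : C} {X : ι → C} {φ : ∀ i, X i ⟶ A}
    {g : A ⟶ A'} (h : StronglyDissects fun i => φ i ≫ g) : StronglyDissects φ :=
  h

/-- Post-composing a weakly dissecting family with a monomorphism `g : A ↣ A'` keeps it weakly
dissecting (cancel `g`). [cite: MochizukiFrdII2008, §0 p.5] -/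
theorem WeaklyDissects.comp_mono {ι : Type w} {A A' : C} {X : ι → C} {φ : ∀ i, X i ⟶ A}
    (h : WeaklyDissects φ) (g : A ⟶ A') [Mono g] : WeaklyDissects fun i => φ i ≫ g :=
  ⟨h.1, fun _ _ hij _ hB ψi ψj heq => h.2 hij hB ψi ψj
    ((cancel_mono g).mp (by simpa only [Category.assoc] using heq))⟩

/-- If the post-composed family `{φᵢ ≫ g}` weakly dissects `A'` then `{φᵢ}` weakly dissects `A`
(any `g`). [cite: MochizukiFrdII2008, §0 p.5] -/
theorem WeaklyDissects.of_comp {ι : Type w} {A A' : C} {X : ι → C} {φ : ∀ i, X i ⟶ A}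
    {g : A ⟶ A'} (h : WeaklyDissects fun i => φ i ≫ g) : WeaklyDissects φ :=
  ⟨h.1, fun i j hij _ hB ψi ψj heq => h.2 hij hB ψi ψj (by
    show ψi ≫ (φ i ≫ g) = ψj ≫ (φ j ≫ g)
    rw [← Category.assoc, heq, Category.assoc])⟩

/-- Strong dissectibility is invariant under isomorphism. [cite: MochizukiFrdII2008, §0 p.5] -/
theorem IsStronglyDissectible.of_iso {A A' : C} (h : IsStronglyDissectible A) (i : A ≅ A') :
    IsStronglyDissectible A' := by
  obtain ⟨X, φ, hφ⟩ := h
  exact ⟨X, fun k => φ k ≫ i.hom, hφ.comp i.hom⟩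

/-- Weak dissectibility is invariant under isomorphism. [cite: MochizukiFrdII2008, §0 p.5] -/
theorem IsWeaklyDissectible.of_iso {A A' : C} (h : IsWeaklyDissectible A) (i : A ≅ A') :
    IsWeaklyDissectible A' := by
  obtain ⟨X, φ, hφ⟩ := h
  exact ⟨X, fun k => φ k ≫ i.hom, hφ.comp_mono i.hom⟩

/-- Strong indissectibility is invariant under isomorphism. [cite: MochizukiFrdII2008, §0 p.5] -/
theorem IsStronglyIndissectible.of_iso {A A' : C} (h : IsStronglyIndissectible A) (i : A ≅ A') :
    IsStronglyIndissectible A' :=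
  fun h' => h (h'.of_iso i.symm)

/-- Weak indissectibility is invariant under isomorphism. [cite: MochizukiFrdII2008, §0 p.5] -/
theorem IsWeaklyIndissectible.of_iso {A A' : C} (h : IsWeaklyIndissectible A) (i : A ≅ A') :
    IsWeaklyIndissectible A' :=
  fun h' => h (h'.of_iso i.symm)

/-! ### (In)dissectible objects under an equivalence -/

/-- `e` carries strongly dissectible objects to strongly dissectible objects.
[cite: MochizukiFrdII2008, §0 p.5] -/
theorem IsStronglyDissectible.map_equivalence {A : C} (h : IsStronglyDissectible A) :
    IsStronglyDissectible (e.functor.obj A) := by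
  obtain ⟨X, φ, hφ⟩ := h
  exact ⟨fun k => e.functor.obj (X k), fun k => e.functor.map (φ k), hφ.map_equivalence e⟩

/-- If `e(A)` is strongly dissectible then so is `A` (transport the dissecting pair along `e⁻¹` and
the unit isomorphism). [cite: MochizukiFrdII2008, §0 p.5] -/
theorem IsStronglyDissectible.of_map_equivalence {A : C}
    (h : IsStronglyDissectible (e.functor.obj A)) : IsStronglyDissectible A :=
  (h.map_equivalence e.symm).of_iso (e.unitIso.app A).symm

/-- `e(A)` is strongly dissectible iff `A` is. [cite: MochizukiFrdII2008, §0 p.5] -/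
theorem isStronglyDissectible_map_equivalence_iff (A : C) :
    IsStronglyDissectible (e.functor.obj A) ↔ IsStronglyDissectible A :=
  ⟨fun h => h.of_map_equivalence e, fun h => h.map_equivalence e⟩

/-- `e` carries weakly dissectible objects to weakly dissectible objects.
[cite: MochizukiFrdII2008, §0 p.5] -/
theorem IsWeaklyDissectible.map_equivalence {A : C} (h : IsWeaklyDissectible A) :
    IsWeaklyDissectible (e.functor.obj A) := by
  obtain ⟨X, φ, hφ⟩ := h
  exact ⟨fun k => e.functor.obj (X k), fun k => e.functor.map (φ k), hφ.map_equivalence e⟩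

/-- If `e(A)` is weakly dissectible then so is `A`. [cite: MochizukiFrdII2008, §0 p.5] -/
theorem IsWeaklyDissectible.of_map_equivalence {A : C}
    (h : IsWeaklyDissectible (e.functor.obj A)) : IsWeaklyDissectible A :=
  (h.map_equivalence e.symm).of_iso (e.unitIso.app A).symm

/-- `e(A)` is weakly dissectible iff `A` is. [cite: MochizukiFrdII2008, §0 p.5] -/
theorem isWeaklyDissectible_map_equivalence_iff (A : C) :
    IsWeaklyDissectible (e.functor.obj A) ↔ IsWeaklyDissectible A :=
  ⟨fun h => h.of_map_equivalence e, fun h => h.map_equivalence e⟩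

/-- `e(A)` is strongly indissectible iff `A` is. [cite: MochizukiFrdII2008, §0 p.5] -/
theorem isStronglyIndissectible_map_equivalence_iff (A : C) :
    IsStronglyIndissectible (e.functor.obj A) ↔ IsStronglyIndissectible A :=
  not_congr (isWeaklyDissectible_map_equivalence_iff e A)

/-- `e(A)` is weakly indissectible iff `A` is. [cite: MochizukiFrdII2008, §0 p.5] -/
theorem isWeaklyIndissectible_map_equivalence_iff (A : C) :
    IsWeaklyIndissectible (e.functor.obj A) ↔ IsWeaklyIndissectible A :=
  not_congr (isStronglyDissectible_map_equivalence_iff e A)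

/-! ### The four dissection types under an equivalence -/

/-- A category equivalent to one of strongly dissectible type is of strongly dissectible type.
[cite: MochizukiFrdII2008, §0 p.5] -/
theorem IsOfStronglyDissectibleType.of_equivalence (e : C ≌ D) (h : IsOfStronglyDissectibleType C) :
    IsOfStronglyDissectibleType D :=
  ⟨fun A' => ((h.isStronglyDissectible (e.inverse.obj A')).map_equivalence e).of_iso
    (e.counitIso.app A')⟩

/-- Being of strongly dissectible type is invariant under equivalence of categories.
[cite: MochizukiFrdII2008, §0 p.5] -/
theorem isOfStronglyDissectibleType_iff_of_equivalence (e : C ≌ D) :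
    IsOfStronglyDissectibleType C ↔ IsOfStronglyDissectibleType D :=
  ⟨fun h => h.of_equivalence e, fun h => h.of_equivalence e.symm⟩

/-- A category equivalent to one of weakly dissectible type is of weakly dissectible type.
[cite: MochizukiFrdII2008, §0 p.5] -/
theorem IsOfWeaklyDissectibleType.of_equivalence (e : C ≌ D) (h : IsOfWeaklyDissectibleType C) :
    IsOfWeaklyDissectibleType D :=
  ⟨fun A' => ((h.isWeaklyDissectible (e.inverse.obj A')).map_equivalence e).of_iso
    (e.counitIso.app A')⟩

/-- Being of weakly dissectible type is invariant under equivalence of categories.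
[cite: MochizukiFrdII2008, §0 p.5] -/
theorem isOfWeaklyDissectibleType_iff_of_equivalence (e : C ≌ D) :
    IsOfWeaklyDissectibleType C ↔ IsOfWeaklyDissectibleType D :=
  ⟨fun h => h.of_equivalence e, fun h => h.of_equivalence e.symm⟩

/-- A category equivalent to one of strongly indissectible type is of strongly indissectible type.
[cite: MochizukiFrdII2008, §0 p.5] -/
theorem IsOfStronglyIndissectibleType.of_equivalence (e : C ≌ D) (h : IsOfStronglyIndissectibleType C) :
    IsOfStronglyIndissectibleType D :=
  ⟨fun A' hA' => h.isStronglyIndissectible (e.inverse.obj A') (hA'.map_equivalence e.symm)⟩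

/-- Being of strongly indissectible type is invariant under equivalence of categories.
[cite: MochizukiFrdII2008, §0 p.5] -/
theorem isOfStronglyIndissectibleType_iff_of_equivalence (e : C ≌ D) :
    IsOfStronglyIndissectibleType C ↔ IsOfStronglyIndissectibleType D :=
  ⟨fun h => h.of_equivalence e, fun h => h.of_equivalence e.symm⟩

/-- A category equivalent to one of weakly indissectible type is of weakly indissectible type.
[cite: MochizukiFrdII2008, §0 p.5] -/
theorem IsOfWeaklyIndissectibleType.of_equivalence (e : C ≌ D) (h : IsOfWeaklyIndissectibleType C) :
    IsOfWeaklyIndissectibleType D :=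
  ⟨fun A' hA' => h.isWeaklyIndissectible (e.inverse.obj A') (hA'.map_equivalence e.symm)⟩

/-- Being of weakly indissectible type is invariant under equivalence of categories.
[cite: MochizukiFrdII2008, §0 p.5] -/
theorem isOfWeaklyIndissectibleType_iff_of_equivalence (e : C ≌ D) :
    IsOfWeaklyIndissectibleType C ↔ IsOfWeaklyIndissectibleType D :=
  ⟨fun h => h.of_equivalence e, fun h => h.of_equivalence e.symm⟩

/-! ### The three kinds of functors, composed with an equivalence -/

section Functors

variable {B : Type u₃} [Category.{v₃} B]

/-- `Φ ⋙ e` is totally non-initial iff `Φ` is. [cite: MochizukiFrdII2008, §0 p.5] -/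
theorem isTotallyNonInitial_comp_equivalence_iff (Φ : B ⥤ C) :
    IsTotallyNonInitial (Φ ⋙ e.functor) ↔ IsTotallyNonInitial Φ :=
  forall_congr' fun X => isNonemptyObj_map_equivalence_iff e (Φ.obj X)

/-- `e ⋙ Ψ` is totally non-initial iff `Ψ` is (every object of `D` is isomorphic to one in the image
of `e`). [cite: MochizukiFrdII2008, §0 p.5] -/
theorem isTotallyNonInitial_equivalence_comp_iff (Ψ : D ⥤ B) :
    IsTotallyNonInitial (e.functor ⋙ Ψ) ↔ IsTotallyNonInitial Ψ := by
  refine ⟨fun h Y => ⟨fun hI => (h (e.inverse.obj Y)).false ?_⟩, fun h X => h (e.functor.obj X)⟩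
  exact hI.ofIso (Ψ.mapIso (e.counitIso.app Y).symm)

/-- `Φ ⋙ e` is relatively initial iff `Φ` is. [cite: MochizukiFrdII2008, §0 p.5] -/
theorem isRelativelyInitial_comp_equivalence_iff (Φ : B ⥤ C) :
    IsRelativelyInitial (Φ ⋙ e.functor) ↔ IsRelativelyInitial Φ := by
  refine ⟨fun h Y => ?_, fun h Y' => ?_⟩
  · obtain ⟨X, ⟨f'⟩⟩ := h (e.functor.obj Y)
    exact ⟨X, ⟨e.functor.preimage f'⟩⟩
  · obtain ⟨X, ⟨f⟩⟩ := h (e.inverse.obj Y')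
    exact ⟨X, ⟨e.functor.map f ≫ e.counit.app Y'⟩⟩

/-- `e ⋙ Ψ` is relatively initial iff `Ψ` is. [cite: MochizukiFrdII2008, §0 p.5] -/
theorem isRelativelyInitial_equivalence_comp_iff (Ψ : D ⥤ B) :
    IsRelativelyInitial (e.functor ⋙ Ψ) ↔ IsRelativelyInitial Ψ := by
  refine ⟨fun h Z => ?_, fun h Z => ?_⟩
  · obtain ⟨X, ⟨f⟩⟩ := h Z
    exact ⟨e.functor.obj X, ⟨f⟩⟩
  · obtain ⟨Y, ⟨f⟩⟩ := h Z
    exact ⟨e.inverse.obj Y, ⟨Ψ.map (e.counit.app Y) ≫ f⟩⟩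

/-- Abstract equivalence of arrows ([FrdI] §0 p. 17: an isomorphism in the arrow category) is
preserved and reflected by an equivalence. [cite: MochizukiFrdII2008, §0 p.5] -/
theorem isAbstractlyEquivalent_map_equivalence_iff {A₁ B₁ A₂ B₂ : C} (f₁ : A₁ ⟶ B₁)
    (f₂ : A₂ ⟶ B₂) :
    IsAbstractlyEquivalent (e.functor.map f₁) (e.functor.map f₂) ↔ IsAbstractlyEquivalent f₁ f₂ :=
  ⟨fun ⟨i⟩ => ⟨e.functor.mapArrow.preimageIso (X := Arrow.mk f₁) (Y := Arrow.mk f₂) i⟩,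
    fun ⟨i⟩ => ⟨e.functor.mapArrow.mapIso (X := Arrow.mk f₁) (Y := Arrow.mk f₂) i⟩⟩

/-- Every arrow `g'` of `D` is abstractly equivalent to the image `e(e⁻¹ g')` of an arrow of `C`.
[cite: MochizukiFrdII2008, §0 p.5] -/
theorem isAbstractlyEquivalent_map_inverse_map {X' Y' : D} (g' : X' ⟶ Y') :
    IsAbstractlyEquivalent (e.functor.map (e.inverse.map g')) g' :=
  ⟨Arrow.isoMk' _ _ (e.counitIso.app X') (e.counitIso.app Y') (e.counit.naturality g').symm⟩

/-- In particular an equivalence is arrow-wise essentially surjective.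
[cite: MochizukiFrdII2008, §0 p.5] -/
theorem isArrowwiseEssSurj_equivalence : IsArrowwiseEssSurj e.functor :=
  fun X' Y' g' => ⟨e.inverse.obj X', e.inverse.obj Y', e.inverse.map g',
    isAbstractlyEquivalent_map_inverse_map e g'⟩

/-- `Φ ⋙ e` is arrow-wise essentially surjective iff `Φ` is. [cite: MochizukiFrdII2008, §0 p.5] -/
theorem isArrowwiseEssSurj_comp_equivalence_iff (Φ : B ⥤ C) :
    IsArrowwiseEssSurj (Φ ⋙ e.functor) ↔ IsArrowwiseEssSurj Φ := by
  refine ⟨fun h X Y g => ?_, fun h X' Y' g' => ?_⟩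
  · obtain ⟨A, A', f, hf⟩ := h (e.functor.map g)
    exact ⟨A, A', f, (isAbstractlyEquivalent_map_equivalence_iff e (Φ.map f) g).mp hf⟩
  · obtain ⟨A, A', f, hf⟩ := h (e.inverse.map g')
    exact ⟨A, A', f, ((isAbstractlyEquivalent_map_equivalence_iff e (Φ.map f) _).mpr hf).trans
      (isAbstractlyEquivalent_map_inverse_map e g')⟩

/-- `e ⋙ Ψ` is arrow-wise essentially surjective iff `Ψ` is. [cite: MochizukiFrdII2008, §0 p.5] -/
theorem isArrowwiseEssSurj_equivalence_comp_iff (Ψ : D ⥤ B) :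
    IsArrowwiseEssSurj (e.functor ⋙ Ψ) ↔ IsArrowwiseEssSurj Ψ := by
  refine ⟨fun h X Y g => ?_, fun h X Y g => ?_⟩
  · obtain ⟨A, A', f, hf⟩ := h g
    exact ⟨e.functor.obj A, e.functor.obj A', e.functor.map f, hf⟩
  · obtain ⟨A, A', f, ⟨i⟩⟩ := h g
    exact ⟨e.inverse.obj A, e.inverse.obj A', e.inverse.map f,
      ⟨Ψ.mapArrow.mapIso (X := Arrow.mk (e.functor.map (e.inverse.map f))) (Y := Arrow.mk f)
        (isAbstractlyEquivalent_map_inverse_map e f).some ≪≫ i⟩⟩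

end Functors

end Literature.AlgebraicGeometry.Frobenioids
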